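import Mathlib.NumberTheory.Padics.RingHoms
import Mathlib.NumberTheory.Padics.Hensel
import Literature.NumberTheory.QuadraticFields.Sqrt41Places
import Mathlib.FieldTheory.IntermediateField.Adjoin.Basic
import Mathlib.FieldTheory.IsAlgClosed.AlgebraicClosure
import Mathlib.Algebra.CubicDiscriminant
import HarnessLib

/-!
# The `2`-adic non-norm certificate for Chevalley's door at `p = 2`

Sub-problem `BirchSwinnertonDyer`, route `ByReductionTypeAtTwo`, item `FineSelmerConjAAtTwoAdditivePotGood` (C1″), helper file.
Chevalley's ambiguous-class door at `p = 2` (`classNumberPExp_one_eq_zero_of_nonNorm_unit_two`, file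
`…ChevalleyDoorAtTwo`) discharges the displayed bit `e₁ = 0` of the one-bit census rows from ONE unit `ε ∈ 𝓞 K` that is not a
norm from `K(√2)`, i.e. `ε ≠ a² − 2b²` for all `a, b ∈ K`.  This file makes that hypothesis DECIDABLE for `K = ℚ(θ)`, `θ` a root of
an irreducible integer cubic `g`:

* §1 `padicInt_two_not_norm` — a `2`-adic integer `u ≡ ±3 (mod 8)` is not `x² − 2y²` with `x, y ∈ ℚ₂` (the Hilbert symbol
  `(u, 2)₂ = −1`; [Serre, Cours d'arithmétique, Ch. III §1.2 Thm. 1]);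
* §2 `exists_padicInt_cubic_root` — HENSEL: from `8 ∣ g(a)`, `2 ∤ g'(a)` a root `z ∈ ℤ₂` of `g` with `z ≡ a (mod 8)`;
* §3 `exists_ringHom_adjoin_padic` — the embedding `ℚ(θ) → ℚ₂`, `θ ↦ z`;
so that `ε = (x + yθ + zθ²)/m` is a non-norm as soon as `(x + ya + za²)·m⁻¹ ≡ ±3 (mod 8)` — a finite check per census row
(`not_sqSubTwoSq_of_padicCert`).

## What this does NOT prove
Nothing here touches `L`-functions or Selmer groups; it is the arithmetic side-car of the `e₁`-bit.  BSD is not advanced by this file.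
-/

set_option autoImplicit false
set_option linter.dupNamespace false

noncomputable section

open Polynomial

namespace Summit.BirchSwinnertonDyer.BirchSwinnertonDyer.Theorems.AddKatoTwo

/-! ## §1 The `2`-adic non-norm criterion -/


/-- In `ZMod 8`, `x² − 2y²` is never `3` or `5`. [folklore] -/
theorem zmod8_sq_sub_two_sq_ne (x y : ZMod 8) : x ^ 2 - 2 * y ^ 2 ≠ 3 ∧ x ^ 2 - 2 * y ^ 2 ≠ 5 := by
  revert x y; decide

/-- **The `2`-adic non-norm criterion**: a `2`-adic integer `u ≡ ±3 (mod 8)` is not of the form `x² − 2y²` with `x, y ∈ ℚ₂`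
(not a norm from `ℚ₂(√2)`: the Hilbert symbol `(u, 2)₂ = −1`). Valuations force `x, y ∈ ℤ₂` (`v(x²)` is even, `v(2y²)` odd), then
reduce mod `8`. [cite: Serre1973, Ch. III §1.2 Thm. 1] -/
theorem padicInt_two_not_norm (u : ℤ_[2]) (hu : PadicInt.toZModPow 3 u = 3 ∨ PadicInt.toZModPow 3 u = 5)
    (x y : ℚ_[2]) : (u : ℚ_[2]) ≠ x ^ 2 - 2 * y ^ 2 := by
  intro h
  -- `u` is a `2`-adic unit
  have hu2 : ¬ (2 : ℤ_[2]) ∣ u := by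
    intro hd
    have hk : u ∈ RingHom.ker (PadicInt.toZModPow (p := 2) 3) → False := fun hk => by
      rw [RingHom.mem_ker] at hk
      rcases hu with h3 | h5
      · rw [hk] at h3; exact absurd h3 (by decide)
      · rw [hk] at h5; exact absurd h5 (by decide)
    -- `2 ∣ u` gives `toZModPow 3 u ∈ 2 • ZMod 8`, contradicting `3, 5` odd
    obtain ⟨c, hc⟩ := hd
    have himg : PadicInt.toZModPow 3 u = 2 * PadicInt.toZModPow 3 c := by rw [hc, map_mul, map_ofNat]
    have hodd : ∀ w : ZMod 8, 2 * w ≠ 3 ∧ 2 * w ≠ 5 := by decide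
    rcases hu with h3 | h5
    · exact (hodd _).1 (himg ▸ h3)
    · exact (hodd _).2 (himg ▸ h5)
  have hu0 : (u : ℚ_[2]) ≠ 0 := by
    intro h0
    apply hu2
    have : u = 0 := Subtype.ext h0
    rw [this]; exact dvd_zero 2
  have hvu : (u : ℚ_[2]).valuation = 0 := by
    have hnorm : ‖u‖ = 1 := by
      rcases lt_or_eq_of_le u.norm_le_one with hlt | heq
      · exact absurd ((PadicInt.norm_lt_one_iff_dvd u).mp hlt) (by exact_mod_cast hu2)
      · exact heq
    have := PadicInt.norm_eq_zpow_neg_valuation (x := u) (by intro h0; exact hu0 (by rw [h0]; rfl))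
    rw [hnorm] at this
    have hv : ((u.valuation : ℤ) : ℤ) = 0 := by
      have h1 : (2 : ℝ) ^ (-(u.valuation : ℤ)) = 1 := by exact_mod_cast this.symm
      rw [zpow_eq_one_iff_right₀ (by norm_num) (by norm_num)] at h1
      omega
    rw [PadicInt.valuation_coe]
    exact_mod_cast hv
  -- valuations of `x` and `y` are non-negative
  have hval : 0 ≤ x.valuation ∧ 0 ≤ y.valuation := by
    by_cases hy : y = 0
    · subst hy
      simp only [ne_eq, zero_pow, OfNat.ofNat_ne_zero, not_false_eq_true, mul_zero, sub_zero] at h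
      have hx : x ≠ 0 := by intro hx; rw [hx, zero_pow two_ne_zero] at h; exact hu0 h
      have := congrArg Padic.valuation h
      rw [hvu, Padic.valuation_pow] at this
      refine ⟨by omega, by rw [Padic.valuation_zero]⟩
    by_cases hx : x = 0
    · subst hx
      simp only [ne_eq, zero_pow, OfNat.ofNat_ne_zero, not_false_eq_true, zero_sub] at h
      have := congrArg Padic.valuation h
      rw [hvu, Literature.NumberTheory.QuadraticFields.Sqrt41.valuation_neg'', Padic.valuation_mul two_ne_zero (pow_ne_zero 2 hy), Padic.valuation_pow,
        show (2 : ℚ_[2]) = ((2 : ℕ) : ℚ_[2]) by norm_num, Padic.valuation_p] at this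
      omega
    set a := x.valuation with ha
    set b := y.valuation with hb
    have hx2 : (x ^ 2).valuation = 2 * a := by rw [Padic.valuation_pow]; rfl
    have h2y2 : (2 * y ^ 2).valuation = 1 + 2 * b := by
      rw [Padic.valuation_mul two_ne_zero (pow_ne_zero 2 hy), Padic.valuation_pow,
        show (2 : ℚ_[2]) = ((2 : ℕ) : ℚ_[2]) by norm_num, Padic.valuation_p]; rfl
    have hx2ne : x ^ 2 ≠ 0 := pow_ne_zero 2 hx
    have h2y2ne : 2 * y ^ 2 ≠ 0 := mul_ne_zero two_ne_zero (pow_ne_zero 2 hy)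
    -- three ultrametric inequalities
    have i1 : min (x ^ 2).valuation (-(2 * y ^ 2)).valuation ≤ (u : ℚ_[2]).valuation := by
      rw [h, sub_eq_add_neg]; exact Padic.le_valuation_add (by rw [← sub_eq_add_neg, ← h]; exact hu0)
    have i2 : min (u : ℚ_[2]).valuation (2 * y ^ 2).valuation ≤ (x ^ 2).valuation := by
      have e : x ^ 2 = (u : ℚ_[2]) + 2 * y ^ 2 := by rw [h]; ring
      rw [e]; exact Padic.le_valuation_add (by rw [← e]; exact hx2ne)
    have i3 : min (x ^ 2).valuation (-(u : ℚ_[2])).valuation ≤ (2 * y ^ 2).valuation := by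
      have e : 2 * y ^ 2 = x ^ 2 + -(u : ℚ_[2]) := by rw [h]; ring
      rw [e]; exact Padic.le_valuation_add (by rw [← e]; exact h2y2ne)
    rw [Literature.NumberTheory.QuadraticFields.Sqrt41.valuation_neg''] at i1 i3
    rw [hx2, h2y2, hvu] at i1 i2 i3
    constructor <;> omega
  -- lift to `ℤ₂` and reduce mod `8`
  obtain ⟨hxv, hyv⟩ := hval
  set X : ℤ_[2] := ⟨x, (Padic.norm_le_one_iff_val_nonneg x).mpr hxv⟩ with hX
  set Y : ℤ_[2] := ⟨y, (Padic.norm_le_one_iff_val_nonneg y).mpr hyv⟩ with hY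
  have hZ : u = X ^ 2 - 2 * Y ^ 2 := by
    apply Subtype.ext
    push_cast
    exact h
  have h8 := congrArg (PadicInt.toZModPow (p := 2) 3) hZ
  rw [map_sub, map_mul, map_pow, map_pow, map_ofNat] at h8
  have := zmod8_sq_sub_two_sq_ne (PadicInt.toZModPow 3 X) (PadicInt.toZModPow 3 Y)
  rcases hu with h3 | h5
  · exact this.1 (h8 ▸ h3)
  · exact this.2 (h8 ▸ h5)

/-! ## §2 Hensel: a `2`-adic root congruent to `a` modulo `8` -/

/-- **Hensel's lemma, quantified mod `8`**: if `8 ∣ g(a)` and `g'(a)` is odd for the integer cubic `g = X³ + pX² + qX + r`, then `g`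
has a root `z ∈ ℤ₂` with `z ≡ a (mod 8)`.  (Mathlib's `hensels_lemma` gives `z ≡ a (mod 2)`; the sharpening `z − a = −g(a)/S` with
`S = z² + za + a² + p(z + a) + q ≡ g'(a)` odd gives `8 ∣ z − a`.) [folklore; cite: Serre1973, Ch. II §2.2] -/
theorem exists_padicInt_cubic_root (p q r a : ℤ) (h8 : (8 : ℤ) ∣ a ^ 3 + p * a ^ 2 + q * a + r)
    (hodd : ¬ (2 : ℤ) ∣ 3 * a ^ 2 + 2 * p * a + q) :
    ∃ z : ℤ_[2], z ^ 3 + p * z ^ 2 + q * z + r = 0 ∧ PadicInt.toZModPow 3 z = ((a : ℤ) : ZMod (2 ^ 3)) := by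
  set F : ℤ[X] := X ^ 3 + C p * X ^ 2 + C q * X + C r with hF
  have hFa : ∀ w : ℤ_[2], F.aeval w = w ^ 3 + p * w ^ 2 + q * w + r := by
    intro w; simp only [hF, map_add, map_mul, map_pow, aeval_X, eq_intCast, map_intCast]
  have hF' : F.derivative = 3 * X ^ 2 + 2 * C p * X + C q := by
    simp only [hF, derivative_add, derivative_mul, derivative_X_pow, derivative_C, derivative_X, zero_mul, zero_add,
      mul_one, add_zero, C_eq_natCast]
    push_cast
    ring
  have hF'a : ∀ w : ℤ_[2], F.derivative.aeval w = 3 * w ^ 2 + 2 * p * w + q := by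
    intro w
    rw [hF']
    simp only [map_add, map_mul, map_pow, aeval_X, eq_intCast, map_intCast, map_ofNat]
  -- the Hensel hypothesis `‖F(a)‖ < ‖F'(a)‖²`
  have hval : F.aeval (a : ℤ_[2]) = ((a ^ 3 + p * a ^ 2 + q * a + r : ℤ) : ℤ_[2]) := by rw [hFa]; push_cast; ring
  have hder : F.derivative.aeval (a : ℤ_[2]) = ((3 * a ^ 2 + 2 * p * a + q : ℤ) : ℤ_[2]) := by rw [hF'a]; push_cast; ring
  have hder1 : ‖F.derivative.aeval (a : ℤ_[2])‖ = 1 := by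
    rw [hder]
    rcases lt_or_eq_of_le (PadicInt.norm_le_one (((3 * a ^ 2 + 2 * p * a + q : ℤ) : ℤ_[2]))) with hlt | heq
    · exact absurd (PadicInt.norm_intCast_lt_one_iff.mp hlt) (by exact_mod_cast hodd)
    · exact heq
  have hnorm : ‖F.aeval (a : ℤ_[2])‖ < ‖F.derivative.aeval (a : ℤ_[2])‖ ^ 2 := by
    rw [hder1, one_pow, hval]
    have h8' : ((2 : ℕ) ^ 3 : ℤ) ∣ a ^ 3 + p * a ^ 2 + q * a + r := by norm_num; exact h8
    have := (PadicInt.norm_int_le_pow_iff_dvd (p := 2)).mpr h8'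
    exact lt_of_le_of_lt this (by norm_num)
  obtain ⟨z, hz0, hza, -, -⟩ := hensels_lemma hnorm
  have hz : z ^ 3 + p * z ^ 2 + q * z + r = 0 := by rw [← hFa]; exact hz0
  refine ⟨z, hz, ?_⟩
  -- `z ≡ a (mod 2)`
  rw [hder1] at hza
  obtain ⟨t, ht⟩ := (PadicInt.norm_lt_one_iff_dvd _).mp hza
  -- the quotient `S = (g(z) − g(a))/(z − a)` is a unit
  have key : (z - a) * (z ^ 2 + z * a + a ^ 2 + p * (z + a) + q) = -(((a ^ 3 + p * a ^ 2 + q * a + r : ℤ) : ℤ_[2])) := by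
    push_cast; linear_combination hz
  have hS : z ^ 2 + z * a + a ^ 2 + p * (z + a) + q =
      ((3 * a ^ 2 + 2 * p * a + q : ℤ) : ℤ_[2]) + 2 * (3 * (a : ℤ_[2]) * t + 2 * t ^ 2 + (p : ℤ_[2]) * t) := by
    have ht' := ht
    push_cast at ht'
    have hz' : z = a + 2 * t := by linear_combination ht'
    rw [hz']; push_cast; ring
  have hunit : IsUnit (z ^ 2 + z * a + a ^ 2 + p * (z + a) + q) := by
    rw [PadicInt.isUnit_iff]
    rcases lt_or_eq_of_le (PadicInt.norm_le_one
      (z ^ 2 + z * (a : ℤ_[2]) + (a : ℤ_[2]) ^ 2 + (p : ℤ_[2]) * (z + (a : ℤ_[2])) + (q : ℤ_[2]))) with hlt | heq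
    · exfalso
      obtain ⟨c, hc⟩ := (PadicInt.norm_lt_one_iff_dvd _).mp hlt
      have hD : (2 : ℤ_[2]) ∣ ((3 * a ^ 2 + 2 * p * a + q : ℤ) : ℤ_[2]) :=
        ⟨c - (3 * (a : ℤ_[2]) * t + 2 * t ^ 2 + (p : ℤ_[2]) * t), by
          have hc' := hc
          push_cast at hc'
          linear_combination hc' - hS⟩
      have : ‖((3 * a ^ 2 + 2 * p * a + q : ℤ) : ℤ_[2])‖ < 1 := (PadicInt.norm_lt_one_iff_dvd _).mpr hD
      exact hodd (PadicInt.norm_intCast_lt_one_iff.mp this)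
    · exact heq
  obtain ⟨S, hSdef⟩ := hunit
  obtain ⟨k, hk⟩ := h8
  have hza8 : z - a = 2 ^ 3 * (-(k : ℤ_[2]) * ↑S⁻¹) := by
    have h1 : (z - a) * ↑S = -(((a ^ 3 + p * a ^ 2 + q * a + r : ℤ) : ℤ_[2])) := by rw [hSdef]; exact key
    rw [hk] at h1
    have h2 : z - a = -(((8 * k : ℤ) : ℤ_[2])) * ↑S⁻¹ := by
      rw [← h1, mul_assoc, Units.mul_inv, mul_one]
    rw [h2]; push_cast; ring
  have hker : z - a ∈ RingHom.ker (PadicInt.toZModPow (p := 2) 3) := by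
    rw [PadicInt.ker_toZModPow, Ideal.mem_span_singleton]
    refine ⟨-(k : ℤ_[2]) * ↑S⁻¹, ?_⟩
    rw [hza8]; push_cast; ring
  rw [RingHom.mem_ker, map_sub, sub_eq_zero] at hker
  rw [hker, map_intCast]

/-! ## §3 The embedding `ℚ(θ) → ℚ₂` -/

/-- **The `2`-adic embedding**: a root `w ∈ ℚ₂` of the irreducible cubic `g = X³ + pX² + qX + r` gives a ring homomorphism
`ℚ(θ) → ℚ₂`, `θ ↦ w` (`ℚ(θ) ≅ ℚ[X]/(g)`). [folklore] -/
theorem exists_ringHom_adjoin_padic {p q r : ℤ} (hirr : Irreducible (Cubic.toPoly ⟨1, (p : ℚ), q, r⟩))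
    {θ : AlgebraicClosure ℚ} (hθ : aeval θ (Cubic.toPoly ⟨1, (p : ℚ), q, r⟩) = 0)
    {w : ℚ_[2]} (hw : w ^ 3 + p * w ^ 2 + q * w + r = 0) :
    ∃ φ : IntermediateField.adjoin ℚ {θ} →+* ℚ_[2], φ ⟨θ, IntermediateField.mem_adjoin_simple_self ℚ θ⟩ = w := by
  have hfm : (Cubic.toPoly ⟨1, (p : ℚ), q, r⟩).Monic := Cubic.monic_of_a_eq_one'
  have hθint : IsIntegral ℚ θ := ⟨_, hfm, by rwa [← aeval_def]⟩
  have hmin : minpoly ℚ θ = Cubic.toPoly ⟨1, (p : ℚ), q, r⟩ := (minpoly.eq_of_irreducible_of_monic hirr hθ hfm).symm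
  have hev : (minpoly ℚ θ).eval₂ (algebraMap ℚ ℚ_[2]) w = 0 := by
    rw [hmin]
    simp only [Cubic.toPoly, map_one, one_mul, eval₂_add, eval₂_mul, eval₂_C, eval₂_X_pow, eval₂_X, eq_ratCast,
      Rat.cast_intCast]
    linear_combination hw
  let ψ : AdjoinRoot (minpoly ℚ θ) →+* ℚ_[2] := AdjoinRoot.lift (algebraMap ℚ ℚ_[2]) w hev
  let e := IntermediateField.adjoinRootEquivAdjoin ℚ hθint
  refine ⟨ψ.comp e.symm.toRingEquiv.toRingHom, ?_⟩
  have hgen : e.symm ⟨θ, IntermediateField.mem_adjoin_simple_self ℚ θ⟩ = AdjoinRoot.root (minpoly ℚ θ) := by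
    rw [AlgEquiv.symm_apply_eq]
    exact (IntermediateField.adjoinRootEquivAdjoin_apply_root ℚ hθint).symm
  change ψ (e.symm ⟨θ, _⟩) = w
  rw [hgen]
  exact AdjoinRoot.lift_root hev

/-! ## §4 The certificate: `ε = (x + yθ + zθ²)/m` is not a norm from `ℚ(θ)(√2)` -/

/-- **The `2`-adic non-norm certificate.**  `θ ∈ ℚ̄` a root of the irreducible cubic `g = X³ + pX² + qX + r ∈ ℤ[X]`, `a ∈ ℤ` with
`8 ∣ g(a)` and `g'(a)` odd (so `θ ↦ z ≡ a (mod 8)` embeds `ℚ(θ) ↪ ℚ₂`), `m` odd with inverse `m' (mod 8)`: if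
`(x + ya + za²)·m' ≡ ±3 (mod 8)` then `ε = (x + yθ + zθ²)/m` is NOT of the form `α² − 2β²`, `α, β ∈ ℚ(θ)` (its image in `ℚ₂` has
Hilbert symbol `(ε, 2)₂ = −1`). [cite: Serre1973, Ch. III §1.2 Thm. 1] -/
theorem not_sqSubTwoSq_of_padicCert {p q r : ℤ} (hirr : Irreducible (Cubic.toPoly ⟨1, (p : ℚ), q, r⟩))
    {θ : AlgebraicClosure ℚ} (hθ : aeval θ (Cubic.toPoly ⟨1, (p : ℚ), q, r⟩) = 0)
    (x y z m a m' : ℤ) (h8 : (8 : ℤ) ∣ a ^ 3 + p * a ^ 2 + q * a + r) (hodd : ¬ (2 : ℤ) ∣ 3 * a ^ 2 + 2 * p * a + q)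
    (hmm : ((m * m' : ℤ) : ZMod (2 ^ 3)) = 1)
    (hcert : (((x + y * a + z * a ^ 2) * m' : ℤ) : ZMod (2 ^ 3)) = 3 ∨
      (((x + y * a + z * a ^ 2) * m' : ℤ) : ZMod (2 ^ 3)) = 5) :
    ∀ α β : IntermediateField.adjoin ℚ {θ},
      algebraMap ℚ _ ((x : ℚ) / m) + algebraMap ℚ _ ((y : ℚ) / m) * ⟨θ, IntermediateField.mem_adjoin_simple_self ℚ θ⟩ +
        algebraMap ℚ _ ((z : ℚ) / m) * ⟨θ, IntermediateField.mem_adjoin_simple_self ℚ θ⟩ ^ 2 ≠ α ^ 2 - 2 * β ^ 2 := by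
  intro α β hEq
  obtain ⟨w, hw, hwa⟩ := exists_padicInt_cubic_root p q r a h8 hodd
  have hw' : (w : ℚ_[2]) ^ 3 + p * (w : ℚ_[2]) ^ 2 + q * (w : ℚ_[2]) + r = 0 := by exact_mod_cast congrArg ((↑) : ℤ_[2] → ℚ_[2]) hw
  obtain ⟨φ, hφ⟩ := exists_ringHom_adjoin_padic hirr hθ hw'
  -- `m` is odd, hence a `2`-adic unit
  have hm2 : ¬ (2 : ℤ) ∣ m := by
    intro ⟨c, hc⟩
    have : ((m * m' : ℤ) : ZMod (2 ^ 3)) = 2 * (c * m' : ℤ) := by rw [hc]; push_cast; ring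
    rw [hmm] at this
    exact absurd this (by generalize ((c * m' : ℤ) : ZMod (2 ^ 3)) = t; revert t; decide)
  have hmunit : IsUnit (m : ℤ_[2]) := by
    rw [PadicInt.isUnit_iff]
    rcases lt_or_eq_of_le (PadicInt.norm_le_one (m : ℤ_[2])) with hlt | heq
    · exact absurd (PadicInt.norm_intCast_lt_one_iff.mp hlt) hm2
    · exact heq
  obtain ⟨M, hM⟩ := hmunit
  have hm0 : (m : ℚ_[2]) ≠ 0 := by
    have : (m : ℤ_[2]) ≠ 0 := by rw [← hM]; exact M.ne_zero
    intro h0; apply this; exact_mod_cast h0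
  -- the image of `ε` is the `2`-adic integer `u = (x + yw + zw²)·m⁻¹`
  set u : ℤ_[2] := (x + y * w + z * w ^ 2) * ↑M⁻¹ with hu
  have hφε : φ (algebraMap ℚ _ ((x : ℚ) / m) + algebraMap ℚ _ ((y : ℚ) / m) * ⟨θ, IntermediateField.mem_adjoin_simple_self ℚ θ⟩ +
      algebraMap ℚ _ ((z : ℚ) / m) * ⟨θ, IntermediateField.mem_adjoin_simple_self ℚ θ⟩ ^ 2) = (u : ℚ_[2]) := by
    simp only [map_add, map_mul, map_pow, hφ]
    have hq : ∀ t : ℚ, φ (algebraMap ℚ (IntermediateField.adjoin ℚ {θ}) t) = (t : ℚ_[2]) := fun t => by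
      rw [eq_ratCast (algebraMap ℚ (IntermediateField.adjoin ℚ {θ})) t]; exact map_ratCast φ t
    rw [hq, hq, hq]
    have hMinv : ((↑M⁻¹ : ℤ_[2]) : ℚ_[2]) = ((m : ℚ_[2]))⁻¹ := by
      have : (↑M⁻¹ : ℤ_[2]) * (m : ℤ_[2]) = 1 := by rw [← hM, Units.inv_mul]
      exact eq_inv_of_mul_eq_one_left (by exact_mod_cast congrArg ((↑) : ℤ_[2] → ℚ_[2]) this)
    rw [hu]; push_cast; rw [hMinv]
    field_simp
  -- its residue mod `8` is `(x + ya + za²)·m'`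
  have hMres : PadicInt.toZModPow 3 (↑M⁻¹ : ℤ_[2]) = ((m' : ℤ) : ZMod (2 ^ 3)) := by
    have h1 : PadicInt.toZModPow 3 (↑M⁻¹ : ℤ_[2]) * ((m : ℤ) : ZMod (2 ^ 3)) = 1 := by
      rw [← map_intCast (PadicInt.toZModPow (p := 2) 3), ← map_mul, ← hM, Units.inv_mul, map_one]
    calc PadicInt.toZModPow 3 (↑M⁻¹ : ℤ_[2])
        = PadicInt.toZModPow 3 (↑M⁻¹ : ℤ_[2]) * ((m * m' : ℤ) : ZMod (2 ^ 3)) := by rw [hmm, mul_one]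
      _ = (PadicInt.toZModPow 3 (↑M⁻¹ : ℤ_[2]) * ((m : ℤ) : ZMod (2 ^ 3))) * ((m' : ℤ) : ZMod (2 ^ 3)) := by
          push_cast; ring
      _ = ((m' : ℤ) : ZMod (2 ^ 3)) := by rw [h1, one_mul]
  have hures : PadicInt.toZModPow 3 u = (((x + y * a + z * a ^ 2) * m' : ℤ) : ZMod (2 ^ 3)) := by
    rw [hu, map_mul, hMres]
    simp only [map_add, map_mul, map_pow, map_intCast, hwa]
    push_cast; ring
  have hu35 : PadicInt.toZModPow 3 u = 3 ∨ PadicInt.toZModPow 3 u = 5 := by rw [hures]; exact hcert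
  have himg := congrArg φ hEq
  rw [hφε, map_sub, map_mul, map_pow, map_pow, map_ofNat] at himg
  exact padicInt_two_not_norm u hu35 (φ α) (φ β) himg

end Summit.BirchSwinnertonDyer.BirchSwinnertonDyer.Theorems.AddKatoTwo

end
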